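import Mathlib
import Literature.NumberTheory.DiophantineGeometry.PartitionTableaux
import Literature.NumberTheory.DiophantineGeometry.StandardFillings
import Literature.NumberTheory.DiophantineGeometry.FirstRowPeeling
import Summits.MatrixMultiplication.MatrixMultiplication.Theorems.SnSubsetDichotomyPolynomialSlackSpechtBranching

/-!
# A quadratic lower bound for the dimensions of the non-linear, non-standard Specht modules

Helper file 2/2 (after `…SpechtBranching`) for the LEVEL-ONE programme on the crux
`SnSubsetDichotomy.PolynomialSlack` (stmt-MatrixMultiplication-8306): the Wedderburn blocks of `ℂ[S_n]`
other than the four of level `≤ 1` — the partitions `(n)`, `(1ⁿ)`, `(n-1,1)`, `(2,1^{n-2})` — have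
dimension `f^μ ≫ n`, so that in the dissected BCGPU identity they are negligible up to volume
`(n!)^{3/2}/n^{1-o(1)}`.

Main result: `quadratic_le_numStandardTableaux` — **for `n ≥ 40` and every partition `μ ⊢ n` all of
whose parts are `≤ n - 2` and which has at most `n - 2` parts, `n(n-1) ≤ 6 f^μ`** (indeed
`C(n,2)/e ≤ f^μ`, `choose_div_exp_le_numStandardTableaux`). The sharp statement is Rasala's: the
minimum is `f^{(n-2,2)} = n(n-3)/2` for `n ≥ 9` [Rasala 1977, Thm. A]; the weak form here is proved by a
self-starting strong induction on `n` over Young diagrams (`sytBound_le_syt`) with the potential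
`𝔅 m = min (C(m,2)/e, 2^{⌊(m-12)/2⌋})` (free for `m ≤ 12`): two corner rows double the bound, a
rectangle doubles it over two steps through its unique child, and a first row (or, transposing, first
column) of exactly `m - 2` cells is bounded directly by the tree's long-first-row inequality
`C(n,j) f^ν ≤ e f^μ` (`choose_mul_numStandardTableaux_le_exp_mul`, with `j = 2`).

References: R. Rasala, *On the minimal degrees of characters of `S_n`*, J. Algebra 45 (1977)
132–181; G. James, *The Representation Theory of the Symmetric Groups*, LNM 682, §9 (branching).
-/

namespace Summit.MatrixMultiplication.MatrixMultiplication.Theorems.PolynomialSlack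

open Literature.NumberTheory.DiophantineGeometry Literature.RepresentationTheory.FiniteGroups

-- `Summit.<Summit>.<Problem>` is the tree's mandated summit-side namespace (CONVENTIONS §2); for
-- this single-conjunct summit the two coincide, so each declaration silences `dupNamespace`.
set_option linter.dupNamespace false

/-! ## The long-first-row bound: `a = |Y| - 2` gives `C(|Y|,2)/e ≤ f^Y` -/

/-- The first row length is the head of `rowLens`. [folklore] -/
theorem head?_rowLens {Y : YoungDiagram} (h : 1 ≤ Y.colLen 0) : Y.rowLens.head? = some (Y.rowLen 0) := by
  obtain ⟨k, hk⟩ : ∃ k, Y.colLen 0 = k + 1 := ⟨Y.colLen 0 - 1, by omega⟩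
  rw [YoungDiagram.rowLens, hk, List.range_succ_eq_map]
  rfl

/-- **Near-hook shapes, directly.** If the first row of `Y` has exactly `|Y| - 2` cells and `|Y| ≥ 6`
then `C(|Y|, 2)/e ≤ f^Y` (the tree's long-first-row inequality `C(n,j) f^ν ≤ e f^μ` with `j = 2`).
[folklore] -/
theorem choose_div_exp_le_syt_of_rowLen {Y : YoungDiagram} (h6 : 6 ≤ Y.cells.card)
    (ha : Y.rowLen 0 + 2 = Y.cells.card) :
    ((Y.cells.card).choose 2 : ℝ) / Real.exp 1 ≤ Nat.card (StdFilling Y.cells.card Y) := by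
  obtain ⟨μ, hμY, -⟩ := exists_partition_youngDiagram_eq Y
  have hn : Y.cells.card ≠ 0 := by omega
  obtain ⟨ν, hs⟩ := exists_sortedParts_eq_sup_cons μ hn
  -- the largest part is the first row
  have hcol : 1 ≤ Y.colLen 0 := one_le_colLen_of_card_pos (by omega)
  have hsup : μ.parts.sup = Y.rowLen 0 := by
    have h1 : Y.rowLens.head? = some μ.parts.sup := by
      have e : μ.youngDiagram.rowLens = μ.parts.sup :: ν.sortedParts := by
        rw [μ.rowLens_youngDiagram, hs]
      rw [hμY] at e
      rw [e]; rfl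
    rw [head?_rowLens hcol] at h1
    exact (Option.some_injective _ h1).symm
  have hj : 2 * (Y.cells.card - μ.parts.sup) ≤ μ.parts.sup := by rw [hsup]; omega
  have key := choose_mul_numStandardTableaux_le_exp_mul hs hj
  have eμ : (numStandardTableaux μ : ℝ) = Nat.card (StdFilling Y.cells.card Y) := by
    rw [numStandardTableaux_eq_card_stdFilling]
    -- `μ.youngDiagram = Y` and `|Y|` is the index
    have : Nat.card (StdFilling Y.cells.card μ.youngDiagram) = Nat.card (StdFilling Y.cells.card Y) := by
      rw [hμY]
    exact_mod_cast this
  rw [eμ] at key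
  have hν : (1 : ℝ) ≤ numStandardTableaux ν := by exact_mod_cast numStandardTableaux_pos_holds ν
  have hchoose : (Y.cells.card).choose (Y.cells.card - μ.parts.sup) = (Y.cells.card).choose 2 := by
    rw [hsup, show Y.cells.card - Y.rowLen 0 = 2 by omega]
  rw [hchoose] at key
  rw [div_le_iff₀ (Real.exp_pos 1)]
  have h0 : (0 : ℝ) ≤ (Y.cells.card).choose 2 := Nat.cast_nonneg _
  calc ((Y.cells.card).choose 2 : ℝ) = (Y.cells.card).choose 2 * 1 := (mul_one _).symm
    _ ≤ (Y.cells.card).choose 2 * numStandardTableaux ν := mul_le_mul_of_nonneg_left hν h0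
    _ ≤ Real.exp 1 * Nat.card (StdFilling Y.cells.card Y) := key
    _ = Nat.card (StdFilling Y.cells.card Y) * Real.exp 1 := mul_comm _ _

/-! ## The potential of the induction -/

/-- The potential is at most `1` for `m ≤ 12` (free base of the induction). [folklore] -/
theorem sytBound_le_one {m : ℕ} (hm : m ≤ 12) : min ((Nat.choose m 2 : ℝ) / Real.exp 1) ((2 : ℝ) ^ ((m - 12) / 2)) ≤ 1 := by
  rw [show (m - 12) / 2 = 0 by omega, pow_zero]
  exact min_le_right _ _

/-- The potential is at most its quadratic component. [folklore] -/
theorem sytBound_le_choose (m : ℕ) : min ((Nat.choose m 2 : ℝ) / Real.exp 1) ((2 : ℝ) ^ ((m - 12) / 2)) ≤ (m.choose 2 : ℝ) / Real.exp 1 := min_le_left _ _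

/-- `C(n+1, 2) = n + C(n, 2)`. [folklore] -/
theorem choose_two_succ (n : ℕ) : (n + 1).choose 2 = n + n.choose 2 := by
  rw [Nat.choose_succ_succ, Nat.choose_one_right]

/-- `n ≤ C(n,2)` for `n ≥ 3`. [folklore] -/
theorem le_choose_two {n : ℕ} (hn : 3 ≤ n) : n ≤ n.choose 2 := by
  obtain ⟨k, rfl⟩ : ∃ k, n = k + 3 := ⟨n - 3, by omega⟩
  induction k with
  | zero => decide
  | succ k ih =>
    rw [show k + 1 + 3 = (k + 3) + 1 by ring, choose_two_succ]
    omega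

/-- `C(m,2) ≤ 2·C(m-1,2)` for `m ≥ 4`. [folklore] -/
theorem choose_two_le_two_mul_pred {m : ℕ} (hm : 4 ≤ m) : m.choose 2 ≤ 2 * (m - 1).choose 2 := by
  obtain ⟨n, rfl⟩ : ∃ n, m = n + 1 := ⟨m - 1, by omega⟩
  rw [choose_two_succ, Nat.add_sub_cancel]
  have := le_choose_two (show 3 ≤ n by omega)
  omega

/-- `C(m,2) ≤ 2·C(m-2,2)` for `m ≥ 8`. [folklore] -/
theorem choose_two_le_two_mul_pred_pred {m : ℕ} (hm : 8 ≤ m) : m.choose 2 ≤ 2 * (m - 2).choose 2 := by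
  obtain ⟨n, rfl⟩ : ∃ n, m = n + 2 := ⟨m - 2, by omega⟩
  rw [show n + 2 = (n + 1) + 1 by ring, choose_two_succ, choose_two_succ,
    show n + 1 + 1 - 2 = n by omega]
  -- need `(n+1) + n ≤ C(n,2)` for `n ≥ 6`
  have key : ∀ k, 6 ≤ k → 2 * k + 1 ≤ k.choose 2 := by
    intro k hk
    obtain ⟨j, rfl⟩ : ∃ j, k = j + 6 := ⟨k - 6, by omega⟩
    induction j with
    | zero => decide
    | succ j ih =>
      rw [show j + 1 + 6 = (j + 6) + 1 by ring, choose_two_succ]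
      omega
  have := key n (by omega)
  omega

/-- One-step doubling: `min ((Nat.choose m 2 : ℝ) / Real.exp 1) ((2 : ℝ) ^ ((m - 12) / 2)) ≤ 2·min ((Nat.choose (m-1) 2 : ℝ) / Real.exp 1) ((2 : ℝ) ^ (((m-1) - 12) / 2))` for `m ≥ 13`. [folklore] -/
theorem sytBound_le_two_mul_pred {m : ℕ} (hm : 13 ≤ m) : min ((Nat.choose m 2 : ℝ) / Real.exp 1) ((2 : ℝ) ^ ((m - 12) / 2)) ≤ 2 * min ((Nat.choose (m - 1) 2 : ℝ) / Real.exp 1) ((2 : ℝ) ^ (((m - 1) - 12) / 2)) := by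
  have he : 0 < Real.exp 1 := Real.exp_pos 1
  rw [mul_min_of_nonneg _ _ (by norm_num : (0 : ℝ) ≤ 2)]
  refine le_min (le_trans (min_le_left _ _) ?_) (le_trans (min_le_right _ _) ?_)
  · rw [mul_div_assoc', div_le_div_iff_of_pos_right he]
    exact_mod_cast choose_two_le_two_mul_pred (by omega)
  · rw [← pow_succ']
    exact pow_le_pow_right₀ (by norm_num) (by omega)

/-- Two-step doubling: `min ((Nat.choose m 2 : ℝ) / Real.exp 1) ((2 : ℝ) ^ ((m - 12) / 2)) ≤ 2·min ((Nat.choose (m-2) 2 : ℝ) / Real.exp 1) ((2 : ℝ) ^ (((m-2) - 12) / 2))` for `m ≥ 13`. [folklore] -/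
theorem sytBound_le_two_mul_pred_pred {m : ℕ} (hm : 13 ≤ m) : min ((Nat.choose m 2 : ℝ) / Real.exp 1) ((2 : ℝ) ^ ((m - 12) / 2)) ≤ 2 * min ((Nat.choose (m - 2) 2 : ℝ) / Real.exp 1) ((2 : ℝ) ^ (((m - 2) - 12) / 2)) := by
  have he : 0 < Real.exp 1 := Real.exp_pos 1
  rw [mul_min_of_nonneg _ _ (by norm_num : (0 : ℝ) ≤ 2)]
  refine le_min (le_trans (min_le_left _ _) ?_) (le_trans (min_le_right _ _) ?_)
  · rw [mul_div_assoc', div_le_div_iff_of_pos_right he]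
    exact_mod_cast choose_two_le_two_mul_pred_pred (by omega)
  · rw [← pow_succ']
    exact pow_le_pow_right₀ (by norm_num) (by omega)

/-- For `m ≥ 40` the potential is the quadratic `C(m,2)/e`. [folklore] -/
theorem sytBound_eq_of_le {m : ℕ} (hm : 40 ≤ m) : min ((Nat.choose m 2 : ℝ) / Real.exp 1) ((2 : ℝ) ^ ((m - 12) / 2)) = (m.choose 2 : ℝ) / Real.exp 1 := by
  refine min_eq_left ?_
  -- `C(m,2) ≤ C(2k+13, 2) = (2k+13)(k+6) ≤ 2^k` with `k = ⌊(m-12)/2⌋ ≥ 14`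
  have key : ∀ k, 14 ≤ k → (2 * k + 13) * (k + 6) ≤ 2 ^ k := by
    intro k hk
    induction k, hk using Nat.le_induction with
    | base => norm_num
    | succ k hk ih =>
      rw [pow_succ]
      nlinarith
  set k := (m - 12) / 2 with hk
  have hk14 : 14 ≤ k := by omega
  have hmk : m ≤ 2 * k + 13 := by omega
  have h1 : m.choose 2 ≤ (2 * k + 13).choose 2 := Nat.choose_le_choose 2 hmk
  have h2 : (2 * k + 13).choose 2 = (2 * k + 13) * (k + 6) := by
    rw [Nat.choose_two_right]
    have : (2 * k + 13) * (2 * k + 13 - 1) = ((2 * k + 13) * (k + 6)) * 2 := by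
      rw [show 2 * k + 13 - 1 = 2 * (k + 6) by omega]; ring
    rw [this, Nat.mul_div_cancel _ (by norm_num)]
  have h3 : (m.choose 2 : ℝ) ≤ 2 ^ k := by
    have := (h1.trans_eq h2).trans (key k hk14)
    exact_mod_cast this
  have he1 : 1 ≤ Real.exp 1 := Real.one_le_exp (by norm_num)
  calc (m.choose 2 : ℝ) / Real.exp 1 ≤ (m.choose 2 : ℝ) / 1 :=
        div_le_div_of_nonneg_left (Nat.cast_nonneg _) one_pos he1
    _ = m.choose 2 := div_one _
    _ ≤ 2 ^ k := h3

/-! ## The induction -/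

/-- Arithmetic of rectangles: `ab ≥ 13`, `a, b ≥ 2` force `a + 4 ≤ ab`. [folklore] -/
theorem add_four_le_mul {a b : ℕ} (hb : 2 ≤ b) (hab : 13 ≤ a * b) : a + 4 ≤ a * b := by
  rcases (show b = 2 ∨ 3 ≤ b by omega) with rfl | hb3
  · omega
  · have := Nat.mul_le_mul_left a hb3
    omega

/-- Removing a corner from a diagram whose first row and first column both have at most `|Y| - 3`
cells leaves a diagram whose first row and column have at most `|Y ⊖ c| - 2` cells. [folklore] -/
theorem nonexc_removeAbove {Y : YoungDiagram} {r n : ℕ} (h : (Y.rowLen (r + 1) < Y.rowLen r))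
    (hY : Y.cells.card = n + 1) (ha : Y.rowLen 0 + 3 ≤ n + 1) (hb : Y.colLen 0 + 3 ≤ n + 1) :
    (Y.removeAbove ((r, Y.rowLen r - 1))).cells.card = n ∧
      (Y.removeAbove ((r, Y.rowLen r - 1))).rowLen 0 + 2 ≤ n ∧
      (Y.removeAbove ((r, Y.rowLen r - 1))).colLen 0 + 2 ≤ n := by
  refine ⟨card_removeAbove_cornerCell h hY, ?_, ?_⟩
  · have := rowLen_le_of_le (removeAbove_le Y ((r, Y.rowLen r - 1))) 0; omega
  · have := colLen_le_of_le (removeAbove_le Y ((r, Y.rowLen r - 1))) 0; omega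

/-- **The lower bound on Young diagrams.** For every Young diagram `Y` with `|Y| = m` whose first row
and first column have at most `m - 2` cells, `min ((Nat.choose m 2 : ℝ) / Real.exp 1) ((2 : ℝ) ^ ((m - 12) / 2)) ≤ f^Y`. Strong induction on `m`:
`m ≤ 12` is free (`f ≥ 1`); a first row (or, transposing, first column) of exactly `m - 2` cells is
the long-first-row bound; otherwise two corner rows give `2·sytBound(m-1)`, and a rectangle gives
`2·sytBound(m-2)` through its unique child. [folklore] -/
theorem sytBound_le_syt : ∀ (m : ℕ) (Y : YoungDiagram), Y.cells.card = m →
    Y.rowLen 0 + 2 ≤ m → Y.colLen 0 + 2 ≤ m → min ((Nat.choose m 2 : ℝ) / Real.exp 1) ((2 : ℝ) ^ ((m - 12) / 2)) ≤ Nat.card (StdFilling Y.cells.card Y) := by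
  intro m
  induction m using Nat.strong_induction_on with
  | _ m ih =>
    intro Y hY ha hb
    -- small sizes are free
    by_cases hm : m ≤ 12
    · exact (sytBound_le_one hm).trans (by exact_mod_cast one_le_card_stdFilling Y)
    have hm13 : 13 ≤ m := by omega
    -- case A: first row of length `m - 2`
    by_cases hA : Y.rowLen 0 + 2 = m
    · refine (sytBound_le_choose m).trans ?_
      rw [← hY] at hA ⊢
      exact choose_div_exp_le_syt_of_rowLen (by omega) hA
    -- case B: first column of length `m - 2` (transpose)
    by_cases hB : Y.colLen 0 + 2 = m
    · refine (sytBound_le_choose m).trans ?_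
      rw [← card_stdFilling_transpose']
      have hY' : Y.transpose.cells.card = m := by rw [YoungDiagram.card_transpose, hY]
      have hA' : Y.transpose.rowLen 0 + 2 = Y.transpose.cells.card := by
        rw [YoungDiagram.rowLen_transpose, hY']; exact hB
      rw [← hY']
      exact choose_div_exp_le_syt_of_rowLen (by omega) hA'
    -- case C: both first row and first column have at most `m - 3` cells
    have ha3 : Y.rowLen 0 + 3 ≤ m := by omega
    have hb3 : Y.colLen 0 + 3 ≤ m := by omega
    obtain ⟨n, rfl⟩ : ∃ n, m = n + 1 := ⟨m - 1, by omega⟩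
    have hcol : 1 ≤ Y.colLen 0 := one_le_colLen_of_card_pos (by omega)
    have hlast : (Y.rowLen (Y.colLen 0 - 1 + 1) < Y.rowLen (Y.colLen 0 - 1)) := isCornerRow_last hcol
    by_cases hex : ∃ r, r + 1 < Y.colLen 0 ∧ (Y.rowLen (r + 1) < Y.rowLen r)
    · -- two distinct corner rows
      obtain ⟨r, hr, hcr⟩ := hex
      obtain ⟨c1, a1, b1⟩ := nonexc_removeAbove hcr hY ha3 hb3
      obtain ⟨c2, a2, b2⟩ := nonexc_removeAbove hlast hY ha3 hb3
      have i1 := ih n (by omega) _ c1 a1 b1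
      have i2 := ih n (by omega) _ c2 a2 b2
      have hsum := add_le_syt_of_isCornerRow hcr hlast (by omega)
      have hsumR : (Nat.card (StdFilling (Y.removeAbove ((r, Y.rowLen r - 1))).cells.card (Y.removeAbove ((r, Y.rowLen r - 1)))) : ℝ) +
          Nat.card (StdFilling (Y.removeAbove ((Y.colLen 0 - 1, Y.rowLen (Y.colLen 0 - 1) - 1))).cells.card (Y.removeAbove ((Y.colLen 0 - 1, Y.rowLen (Y.colLen 0 - 1) - 1)))) ≤ Nat.card (StdFilling Y.cells.card Y) := by exact_mod_cast hsum
      have hrec := sytBound_le_two_mul_pred hm13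
      rw [Nat.add_sub_cancel] at hrec
      linarith
    · -- a rectangle `a × b`
      push Not at hex
      set a := Y.rowLen 0 with ha_def
      set b := Y.colLen 0 with hb_def
      have hrect : ∀ r, r < b → Y.rowLen r = a := fun r hr =>
        rowLen_eq_rowLen_zero_of_no_corner (fun r hr => not_lt.2 (hex r hr)) hr
      have hab : n + 1 = a * b := hY ▸ card_eq_mul_of_rect hrect
      have ha2 : 2 ≤ a := by
        by_contra hlt
        have := card_eq_colLen_of_rowLen_le_one (Y := Y) (by omega)
        omega
      have hb2 : 2 ≤ b := by
        by_contra hlt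
        have := card_eq_rowLen_of_colLen_le_one (Y := Y) (by omega)
        omega
      have ha4 : a + 4 ≤ n + 1 := hab ▸ add_four_le_mul hb2 (by omega)
      have hb4 : b + 4 ≤ n + 1 := by
        rw [hab, mul_comm]; exact add_four_le_mul ha2 (by rw [mul_comm]; omega)
      -- the unique child `Z`
      set Z := Y.removeAbove ((b - 1, Y.rowLen (b - 1) - 1)) with hZ
      obtain ⟨m', rfl⟩ : ∃ m', n = m' + 1 := ⟨n - 1, by omega⟩
      have cZ : Z.cells.card = m' + 1 := card_removeAbove_cornerCell hlast hY
      have hZrow : ∀ r, r < b - 1 → Z.rowLen r = a := fun r hr => by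
        rw [hZ, rowLen_removeAbove_cornerCell_of_ne hlast (by omega)]; exact hrect r (by omega)
      have hZlast : Z.rowLen (b - 1) = a - 1 := by
        rw [hZ, rowLen_removeAbove_cornerCell_self hlast, hrect (b - 1) (by omega)]
      have hZb : Z.rowLen b = 0 := by
        rw [hZ, rowLen_removeAbove_cornerCell_of_ne hlast (by omega)]
        exact VershikKerov.rowLen_eq_zero _ le_rfl
      have hc1 : (Z.rowLen (b - 1 + 1) < Z.rowLen (b - 1)) := by
        rw [show b - 1 + 1 = b by omega, hZb, hZlast]; omega
      have hc2 : (Z.rowLen (b - 2 + 1) < Z.rowLen (b - 2)) := by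
        rw [show b - 2 + 1 = b - 1 by omega, hZlast, hZrow (b - 2) (by omega)]
        omega
      have haZ : Z.rowLen 0 + 3 ≤ m' + 1 := by
        have := rowLen_le_of_le (removeAbove_le Y ((b - 1, Y.rowLen (b - 1) - 1))) 0
        rw [← hZ] at this; omega
      have hbZ : Z.colLen 0 + 3 ≤ m' + 1 := by
        have := colLen_le_of_le (removeAbove_le Y ((b - 1, Y.rowLen (b - 1) - 1))) 0
        rw [← hZ] at this; omega
      obtain ⟨c1, a1, b1⟩ := nonexc_removeAbove hc1 cZ haZ hbZ
      obtain ⟨c2, a2, b2⟩ := nonexc_removeAbove hc2 cZ haZ hbZ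
      have i1 := ih m' (by omega) _ c1 a1 b1
      have i2 := ih m' (by omega) _ c2 a2 b2
      have hsum := add_le_syt_of_isCornerRow hc1 hc2 (by omega)
      have hsumR : (Nat.card (StdFilling (Z.removeAbove ((b - 1, Z.rowLen (b - 1) - 1))).cells.card (Z.removeAbove ((b - 1, Z.rowLen (b - 1) - 1)))) : ℝ) +
          Nat.card (StdFilling (Z.removeAbove ((b - 2, Z.rowLen (b - 2) - 1))).cells.card (Z.removeAbove ((b - 2, Z.rowLen (b - 2) - 1)))) ≤ Nat.card (StdFilling Z.cells.card Z) := by exact_mod_cast hsum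
      have hZY : (Nat.card (StdFilling Z.cells.card Z) : ℝ) ≤ Nat.card (StdFilling Y.cells.card Y) := by exact_mod_cast le_syt_of_isCornerRow hlast
      have hrec := sytBound_le_two_mul_pred_pred hm13
      rw [show m' + 1 + 1 - 2 = m' by omega] at hrec
      linarith

/-! ## The bound for partitions -/

/-- The first row of the diagram of `μ` is a part of `μ` (or the diagram is empty). [folklore] -/
theorem rowLen_zero_mem_parts_or {d : ℕ} (μ : Nat.Partition d) :
    μ.youngDiagram.rowLen 0 ∈ μ.parts ∨ μ.youngDiagram.rowLen 0 = 0 := by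
  rcases Nat.eq_zero_or_pos (μ.youngDiagram.colLen 0) with h | h
  · exact Or.inr (VershikKerov.rowLen_eq_zero _ (by omega))
  · left
    have h1 : μ.youngDiagram.rowLens.head? = some (μ.youngDiagram.rowLen 0) := head?_rowLens h
    rw [μ.rowLens_youngDiagram] at h1
    have h2 : μ.youngDiagram.rowLen 0 ∈ μ.sortedParts := List.mem_of_mem_head? h1
    exact (Multiset.mem_sort _).1 h2

/-- The first column of the diagram of `μ` has `μ.parts.card` cells. [folklore] -/
theorem colLen_zero_youngDiagram {d : ℕ} (μ : Nat.Partition d) :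
    μ.youngDiagram.colLen 0 = μ.parts.card := by
  rw [← YoungDiagram.length_rowLens, μ.rowLens_youngDiagram, μ.length_sortedParts]

/-- **Quadratic lower bound for Specht dimensions (weak Rasala).** For `n ≥ 40` and a partition
`μ ⊢ n` all of whose parts are at most `n - 2` and which has at most `n - 2` parts — i.e. `μ` is none of
`(n)`, `(n-1,1)`, `(1ⁿ)`, `(2,1^{n-2})` — the number of standard Young tableaux satisfies
`C(n,2)/e ≤ f^μ`. (Rasala 1977 gives the sharp minimum `n(n-3)/2` for `n ≥ 9`.) [folklore] -/
theorem choose_div_exp_le_numStandardTableaux {n : ℕ} (hn : 40 ≤ n) (μ : Nat.Partition n)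
    (hrow : ∀ a ∈ μ.parts, a + 2 ≤ n) (hcol : μ.parts.card + 2 ≤ n) :
    (n.choose 2 : ℝ) / Real.exp 1 ≤ numStandardTableaux μ := by
  rw [numStandardTableaux_eq_card_stdFilling', ← sytBound_eq_of_le hn]
  refine sytBound_le_syt n μ.youngDiagram μ.card_cells_youngDiagram ?_ ?_
  · rcases rowLen_zero_mem_parts_or μ with h | h
    · exact hrow _ h
    · omega
  · rw [colLen_zero_youngDiagram]; exact hcol

/-- **Quadratic lower bound for Specht dimensions, integer form**: under the same hypotheses,
`n(n-1) ≤ 6 f^μ`. [folklore] -/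
theorem quadratic_le_numStandardTableaux {n : ℕ} (hn : 40 ≤ n) (μ : Nat.Partition n)
    (hrow : ∀ a ∈ μ.parts, a + 2 ≤ n) (hcol : μ.parts.card + 2 ≤ n) :
    n * (n - 1) ≤ 6 * numStandardTableaux μ := by
  have h := choose_div_exp_le_numStandardTableaux hn μ hrow hcol
  rw [div_le_iff₀ (Real.exp_pos 1)] at h
  have he : Real.exp 1 < 3 := lt_trans Real.exp_one_lt_d9 (by norm_num)
  have hf : (0 : ℝ) ≤ numStandardTableaux μ := Nat.cast_nonneg _
  have h2 : (n.choose 2 : ℝ) * 2 = n * (n - 1 : ℕ) := by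
    have := Nat.choose_two_right n
    have hdvd : 2 ∣ n * (n - 1) := (Nat.even_mul_pred_self n).two_dvd
    have e : n.choose 2 * 2 = n * (n - 1) := by rw [this, Nat.div_mul_cancel hdvd]
    exact_mod_cast e
  have h3 : ((n * (n - 1) : ℕ) : ℝ) ≤ 6 * numStandardTableaux μ := by
    push_cast
    rw [← h2]
    nlinarith [mul_nonneg hf (show (0 : ℝ) ≤ 3 - Real.exp 1 by linarith)]
  exact_mod_cast h3

end Summit.MatrixMultiplication.MatrixMultiplication.Theorems.PolynomialSlack
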